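import Summits.NavierStokesRegularity.NavierStokesRegularity.Theorems.SqueezeCycleRecurrentLiouvilleNearIdentityDSS
import Summits.NavierStokesRegularity.NavierStokesRegularity.Theorems.SqueezeCycleRecurrentLiouvilleRotationOrbitContinuous
import HarnessLib

/-!
# Crux `RecurrentLiouville` (stmt-NavierStokesRegularity-1589), line `Sketch` — near-identity ROTATED
  discretely self-similar profiles with slow precession are regular (Albritton–Barker class)

`stub_rlNearIdentityRDSSSlow`: ∀ `C`, `M < ⊤` ∃ `Λ > 1`, `α_ > 0`: a class profile (suitable weak on
`ℝ³ × ℝ₋`, weak gradient, `𝐈 ≤ M`, rate `C`) which is a.e. `(λ, θ)`-ROTATED-DSS on the slab —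
`λ u(λ²t, λx) = R_θ u(t, R_{−θ} x)` a.e. — with `λ ∈ (1, Λ)` and `|θ| ≤ α_ log λ` is regular at the
origin.  Generalises `stub_rlNearIdentityDSS` (`θ = 0`, Chae–Wolf 2017 Thm 1.3 / Pineau–Vicol 2026
Thm 1.6 in the A–B class) and is the discrete form of the slow rotated-self-similar rung
(Pineau–Vicol Thm 1.7-type, slow effective precession `θ/log λ`).  Proof by compactness
(`stub_rlClassLimit`): the integer powers `c_k = λ_k^{n_k} → e^σ`, `n_k = ⌊σ/log λ_k⌋`, carry the
rotation `R_{n_k θ_k}` (`rlRDSS_ae_pow`, the rotated iteration of the a.e. identity) with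
`|n_k θ_k| ≤ α_k σ → 0` (`rlRDSS_angles`); on every ball `‖w_{e^σ} − w‖_{L³(Q(0,R))}` is bounded by
`‖w_{e^σ} − w_{c_k}‖ + ‖w_{c_k} − (u_k)_{c_k}‖ + ‖R_{φ_k}(u_k∘T_{−φ_k}) − R_{φ_k}(w∘T_{−φ_k})‖ +
‖R_{φ_k}(w∘T_{−φ_k}) − w‖ → 0` (continuity of the scaling orbit `stub_rlOrbitContinuous`, exact
scaling law, isometry of the rotated conjugation `rlRotAbs_eLpNorm_conj`, continuity of the
rotation orbit `stub_rlRotationOrbitContinuousTools`) — `rlRDSS_ball`; so the class limit `w` is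
a.e. self-similar, hence a.e. a pointwise self-similar Type-I ancient mild field
(`stub_rlSelfSimilarRepr`), which vanishes (`stub_rlSelfSimilarMildVanishes`, Tsai 1998 Thm 1) —
contradicting its singular origin.
References: [PineauVicol2026] Thms. 1.6–1.7; [ChaeWolf2017RemovingDSS] arXiv:1610.09464 Thm 1.3;
[Tsai1998] Thm 1; [AlbrittonBarker2019] arXiv:1811.00502 Lemma 2.2, Prop. 2.3.
-/

noncomputable section

-- the sub-problem namespace repeats the summit name (D-0017 layout `Summit.<S>.<P>.Theorems`)
set_option linter.dupNamespace false

namespace Summit.NavierStokesRegularity.NavierStokesRegularity.Theorems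

open MeasureTheory Set Function Filter Topology TopologicalSpace Metric Literature.Analysis.FluidPDE
open scoped NNReal ENNReal

/-- **Transport of an a.e. identity along a space–time rotation.**  If `F z = G z` for a.e. `z` in
the open backward slab, then `F (t, R_φ x) = G (t, R_φ x)` for a.e. `(t, x)` in the slab: the rotation
`(t, x) ↦ (t, R_φ x)` preserves Lebesgue measure and the slab. [folklore] -/
theorem rlRDSS_ae_rot_comp {F G : ℝ × EuclideanSpace ℝ (Fin 3) → EuclideanSpace ℝ (Fin 3)} (φ : ℝ)
    (h : ∀ᵐ z ∂(volume.restrict (Iio (0 : ℝ) ×ˢ (univ : Set (EuclideanSpace ℝ (Fin 3))))), F z = G z) :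
    ∀ᵐ z ∂(volume.restrict (Iio (0 : ℝ) ×ˢ (univ : Set (EuclideanSpace ℝ (Fin 3))))),
      F (z.1, rotZ φ z.2) = G (z.1, rotZ φ z.2) := by
  have hmp := (Seregin2020.measurePreserving_rotST φ).restrict_preimage
    ((measurableSet_Iio (a := (0 : ℝ))).prod (MeasurableSet.univ (α := EuclideanSpace ℝ (Fin 3))))
  have hpre : (fun z : ℝ × EuclideanSpace ℝ (Fin 3) => (z.1, rotZ φ z.2)) ⁻¹'
      (Iio (0 : ℝ) ×ˢ (univ : Set (EuclideanSpace ℝ (Fin 3)))) = Iio (0 : ℝ) ×ˢ (univ : Set (EuclideanSpace ℝ (Fin 3))) := by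
    ext z
    simp [mem_prod]
  rw [hpre] at hmp
  exact hmp.quasiMeasurePreserving.ae h

/-- **Iterating an a.e. rotated discrete self-similarity.**  If `u_λ = R_θ (u ∘ T_{−θ})` a.e. on the
slab (`λ > 0`), then `u_{λⁿ} = R_{nθ} (u ∘ T_{−nθ})` a.e. on the slab for every `n : ℕ` (scalings
commute with rotations, `rotZ_smul`; transport along dilations and rotations). [folklore] -/
theorem rlRDSS_ae_pow {u : ℝ → EuclideanSpace ℝ (Fin 3) → EuclideanSpace ℝ (Fin 3)} {lam θ : ℝ} (hlam : 0 < lam)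
    (h : ∀ᵐ z ∂(volume.restrict (Iio (0 : ℝ) ×ˢ (univ : Set (EuclideanSpace ℝ (Fin 3))))),
      nsRescale lam u z.1 z.2 = rotZ θ (u z.1 (rotZ (-θ) z.2))) (n : ℕ) :
    ∀ᵐ z ∂(volume.restrict (Iio (0 : ℝ) ×ˢ (univ : Set (EuclideanSpace ℝ (Fin 3))))),
      nsRescale (lam ^ n) u z.1 z.2 = rotZ (n * θ) (u z.1 (rotZ (-(n * θ)) z.2)) := by
  induction n with
  | zero =>
      exact Eventually.of_forall fun z => by
        simp only [pow_zero, nsRescale_one, Nat.cast_zero, zero_mul, neg_zero, rotZ_zero]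
  | succ n ih =>
      have hcn : 0 < lam ^ n := pow_pos hlam n
      -- transport `u_λ = R_θ(u∘T_{−θ})` along the dilation by `λⁿ`, and the induction
      -- hypothesis along the rotation `T_{−θ}`
      have ht := rlNearIdentityDSS_ae_comp_dilation (F := fun z => nsRescale lam u z.1 z.2)
        (G := fun z => rotZ θ (u z.1 (rotZ (-θ) z.2))) hcn h
      have hr := rlRDSS_ae_rot_comp (-θ) (F := fun z => nsRescale (lam ^ n) u z.1 z.2)
        (G := fun z => rotZ (n * θ) (u z.1 (rotZ (-(n * θ)) z.2))) ih
      filter_upwards [ht, hr] with z hz hz'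
      have e1 : ((n + 1 : ℕ) : ℝ) * θ = θ + n * θ := by push_cast; ring
      have e2 : -(θ + (n : ℝ) * θ) = -(n * θ) + -θ := by ring
      rw [e1, e2, rotZ_add, rotZ_add, pow_succ', nsRescale_mul, nsRescale_apply, hz, rotZ_smul (-θ),
        ← rotZ_smul θ, ← nsRescale_apply (lam ^ n) u, hz']

/-- **The carried angles are small.**  If `|θ_k| ≤ α_k log λ_k` with `λ_k > 1` and `α_k → 0`, then
for `σ > 0` the angles `⌊σ / log λ_k⌋ θ_k` carried by the integer powers `λ_k^{⌊σ/log λ_k⌋} ≤ e^σ`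
tend to `0` (`|⌊σ/log λ_k⌋ θ_k| ≤ |α_k| σ`). [folklore] -/
theorem rlRDSS_angles {lam θ α : ℕ → ℝ} (hlam : ∀ k, 1 < lam k)
    (hθ : ∀ k, |θ k| ≤ α k * Real.log (lam k)) (hα : Tendsto α atTop (𝓝 0)) {σ : ℝ} (hσ : 0 < σ) :
    Tendsto (fun k => (⌊σ / Real.log (lam k)⌋₊ : ℝ) * θ k) atTop (𝓝 0) := by
  have hlog : ∀ k, 0 < Real.log (lam k) := fun k => Real.log_pos (hlam k)
  have hup : ∀ k, (⌊σ / Real.log (lam k)⌋₊ : ℝ) * Real.log (lam k) ≤ σ := fun k => by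
    have h1 : (⌊σ / Real.log (lam k)⌋₊ : ℝ) ≤ σ / Real.log (lam k) :=
      Nat.floor_le (div_nonneg hσ.le (hlog k).le)
    calc (⌊σ / Real.log (lam k)⌋₊ : ℝ) * Real.log (lam k)
        ≤ σ / Real.log (lam k) * Real.log (lam k) := mul_le_mul_of_nonneg_right h1 (hlog k).le
      _ = σ := div_mul_cancel₀ σ (hlog k).ne'
  have hb : Tendsto (fun k => |α k| * σ) atTop (𝓝 0) := by
    have h := hα.abs.mul_const σ
    rwa [abs_zero, zero_mul] at h
  refine squeeze_zero_norm (fun k => ?_) hb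
  rw [Real.norm_eq_abs, abs_mul, Nat.abs_cast]
  calc (⌊σ / Real.log (lam k)⌋₊ : ℝ) * |θ k|
      ≤ (⌊σ / Real.log (lam k)⌋₊ : ℝ) * (α k * Real.log (lam k)) :=
        mul_le_mul_of_nonneg_left (hθ k) (Nat.cast_nonneg _)
    _ = α k * ((⌊σ / Real.log (lam k)⌋₊ : ℝ) * Real.log (lam k)) := by ring
    _ ≤ |α k| * ((⌊σ / Real.log (lam k)⌋₊ : ℝ) * Real.log (lam k)) :=
        mul_le_mul_of_nonneg_right (le_abs_self _) (mul_nonneg (Nat.cast_nonneg _) (hlog k).le)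
    _ ≤ |α k| * σ := mul_le_mul_of_nonneg_left (hup k) (abs_nonneg _)

/-- **Main estimate (`σ > 0`, one ball).**  If `λ_k → 1⁺`, `|θ_k| ≤ α_k log λ_k` with `α_k → 0`,
`u_k → w` in every `L³(Q(0, R))`, `(u_k)_{λ_k} = R_{θ_k}(u_k ∘ T_{−θ_k})` a.e. on the slab, and the
scaling and rotation orbits of `w` are continuous in `L³` on the balls, then
`‖w_{e^σ} − w‖_{L³(Q(0,R))} = 0`: through the integer powers `c_k = λ_k^{n_k} → e^σ`, which act on
`u_k` as the rotations `R_{n_k θ_k}`, `n_k θ_k → 0` (four-term splitting; exact scaling law,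
`1 ≤ c_k ≤ e^σ`; isometry of the rotated conjugation). [folklore] -/
theorem rlRDSS_ball
    {lam θ α : ℕ → ℝ} (hlam : ∀ k, 1 < lam k) (hlim : Tendsto lam atTop (𝓝 1))
    (hθ : ∀ k, |θ k| ≤ α k * Real.log (lam k)) (hα : Tendsto α atTop (𝓝 0))
    {u : ℕ → ℝ → EuclideanSpace ℝ (Fin 3) → EuclideanSpace ℝ (Fin 3)}
    {w : ℝ → EuclideanSpace ℝ (Fin 3) → EuclideanSpace ℝ (Fin 3)}
    (hum : ∀ (k : ℕ) (c : ℝ), 0 < c → ∀ R : ℝ, 0 < R → AEStronglyMeasurable (uncurry (nsRescale c (u k)))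
      (volume.restrict (parabolicCylinder R (0 : ℝ × EuclideanSpace ℝ (Fin 3)))))
    (hwm : ∀ (c : ℝ), 0 < c → ∀ R : ℝ, 0 < R → AEStronglyMeasurable (uncurry (nsRescale c w))
      (volume.restrict (parabolicCylinder R (0 : ℝ × EuclideanSpace ℝ (Fin 3)))))
    (hconv : ∀ R : ℝ, 0 < R → Tendsto (fun k => eLpNorm (uncurry (u k) - uncurry w) 3
      (volume.restrict (parabolicCylinder R (0 : ℝ × EuclideanSpace ℝ (Fin 3))))) atTop (𝓝 0))
    (hdss : ∀ k, ∀ᵐ z ∂(volume.restrict (Iio (0 : ℝ) ×ˢ (univ : Set (EuclideanSpace ℝ (Fin 3))))),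
      nsRescale (lam k) (u k) z.1 z.2 = rotZ (θ k) (u k z.1 (rotZ (-θ k) z.2)))
    (horbit : ∀ R : ℝ, 0 < R → Tendsto (fun c : ℝ => eLpNorm (uncurry (nsRescale c w) - uncurry w) 3
      (volume.restrict (parabolicCylinder R (0 : ℝ × EuclideanSpace ℝ (Fin 3))))) (𝓝 1) (𝓝 0))
    (hrot : ∀ R : ℝ, 0 < R → Tendsto (fun φ : ℝ => eLpNorm (fun z : ℝ × EuclideanSpace ℝ (Fin 3) =>
        rotZ φ (w z.1 (rotZ (-φ) z.2)) - w z.1 z.2) 3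
      (volume.restrict (parabolicCylinder R (0 : ℝ × EuclideanSpace ℝ (Fin 3))))) (𝓝 0) (𝓝 0))
    {σ : ℝ} (hσ : 0 < σ) {R : ℝ} (hR : 0 < R) :
    eLpNorm (uncurry (nsRescale (Real.exp σ) w) - uncurry w) 3
      (volume.restrict (parabolicCylinder R (0 : ℝ × EuclideanSpace ℝ (Fin 3)))) = 0 := by
  -- the approximating integer powers `c_k = λ_k^{n_k} → e^σ` and the carried angles `φ_k = n_k θ_k → 0`
  set c : ℕ → ℝ := fun k => Real.exp ((⌊σ / Real.log (lam k)⌋₊ : ℝ) * Real.log (lam k)) with hc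
  set φ : ℕ → ℝ := fun k => (⌊σ / Real.log (lam k)⌋₊ : ℝ) * θ k with hφ
  obtain ⟨hclim, hc1, hcle⟩ := rlNearIdentityDSS_scales hlam hlim hσ
  have hφ0 : Tendsto φ atTop (𝓝 0) := rlRDSS_angles hlam hθ hα hσ
  have hc0 : ∀ k, 0 < c k := fun k => Real.exp_pos _
  have he : 0 < Real.exp σ := Real.exp_pos σ
  -- `(u_k)_{c_k} = R_{φ_k}(u_k ∘ T_{−φ_k})` a.e. on the slab
  have hfix : ∀ k, ∀ᵐ z ∂(volume.restrict (Iio (0 : ℝ) ×ˢ (univ : Set (EuclideanSpace ℝ (Fin 3))))),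
      nsRescale (c k) (u k) z.1 z.2 = rotZ (φ k) (u k z.1 (rotZ (-φ k) z.2)) := by
    intro k
    have h := rlRDSS_ae_pow (zero_lt_one.trans (hlam k)) (hdss k) ⌊σ / Real.log (lam k)⌋₊
    have e : c k = lam k ^ ⌊σ / Real.log (lam k)⌋₊ := by
      rw [hc]; dsimp only; rw [Real.exp_nat_mul, Real.exp_log (zero_lt_one.trans (hlam k))]
    rw [e]
    exact h
  -- notation for the measure and the players
  set μR : Measure (ℝ × EuclideanSpace ℝ (Fin 3)) :=
    volume.restrict (parabolicCylinder R (0 : ℝ × EuclideanSpace ℝ (Fin 3))) with hμR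
  set F : ℝ × EuclideanSpace ℝ (Fin 3) → EuclideanSpace ℝ (Fin 3) := uncurry (nsRescale (Real.exp σ) w) with hF
  set G : ℕ → ℝ × EuclideanSpace ℝ (Fin 3) → EuclideanSpace ℝ (Fin 3) :=
    fun k => uncurry (nsRescale (c k) w) with hG
  set Hk : ℕ → ℝ × EuclideanSpace ℝ (Fin 3) → EuclideanSpace ℝ (Fin 3) :=
    fun k => uncurry (nsRescale (c k) (u k)) with hHk
  set Rk : ℕ → ℝ × EuclideanSpace ℝ (Fin 3) → EuclideanSpace ℝ (Fin 3) :=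
    fun k z => rotZ (φ k) (uncurry (u k) (z.1, rotZ (-φ k) z.2)) with hRk
  set Rw : ℕ → ℝ × EuclideanSpace ℝ (Fin 3) → EuclideanSpace ℝ (Fin 3) :=
    fun k z => rotZ (φ k) (uncurry w (z.1, rotZ (-φ k) z.2)) with hRw
  have hwm1 : ∀ r : ℝ, 0 < r → AEStronglyMeasurable (uncurry w)
      (volume.restrict (parabolicCylinder r (0 : ℝ × EuclideanSpace ℝ (Fin 3)))) := by
    intro r hr
    have h := hwm 1 one_pos r hr
    rwa [nsRescale_one] at h
  have hum1 : ∀ (k : ℕ) (r : ℝ), 0 < r → AEStronglyMeasurable (uncurry (u k))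
      (volume.restrict (parabolicCylinder r (0 : ℝ × EuclideanSpace ℝ (Fin 3)))) := by
    intro k r hr
    have h := hum k 1 one_pos r hr
    rwa [nsRescale_one] at h
  have hFm : AEStronglyMeasurable F μR := hwm _ he R hR
  have hWm : AEStronglyMeasurable (uncurry w) μR := hwm1 R hR
  have hGm : ∀ k, AEStronglyMeasurable (G k) μR := fun k => hwm _ (hc0 k) R hR
  have hHm : ∀ k, AEStronglyMeasurable (Hk k) μR := fun k => hum k _ (hc0 k) R hR
  have hRkm : ∀ k, AEStronglyMeasurable (Rk k) μR := fun k =>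
    rlRotAbs_aesm_conj (φ k) R (g := uncurry (u k)) (hum1 k R hR)
  have hRwm : ∀ k, AEStronglyMeasurable (Rw k) μR := fun k =>
    rlRotAbs_aesm_conj (φ k) R (g := uncurry w) (hwm1 R hR)
  -- `H_k = R_{φ_k}(u_k ∘ T_{−φ_k})` a.e. on the ball
  have hHae : ∀ k, Hk k =ᵐ[μR] Rk k := fun k =>
    ae_restrict_of_ae_restrict_of_subset (parabolicCylinder_origin_subset_slab R) (hfix k)
  -- the four-term bound
  have h13 : (1 : ℝ≥0∞) ≤ 3 := by norm_num
  have hle : ∀ k, eLpNorm (F - uncurry w) 3 μR ≤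
      eLpNorm (F - G k) 3 μR +
        ENNReal.ofReal (Real.exp σ) * eLpNorm (uncurry (u k) - uncurry w) 3
          (volume.restrict (parabolicCylinder (Real.exp σ * R) (0 : ℝ × EuclideanSpace ℝ (Fin 3)))) +
        (eLpNorm (uncurry (u k) - uncurry w) 3 μR +
          eLpNorm (fun z : ℝ × EuclideanSpace ℝ (Fin 3) => rotZ (φ k) (w z.1 (rotZ (-φ k) z.2)) - w z.1 z.2) 3 μR) := by
    intro k
    have e : F - uncurry w = (F - G k) + ((G k - Hk k) + (Hk k - uncurry w)) := by
      rw [sub_add_sub_cancel, sub_add_sub_cancel]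
    have hB : eLpNorm (G k - Hk k) 3 μR ≤
        ENNReal.ofReal (Real.exp σ) * eLpNorm (uncurry (u k) - uncurry w) 3
          (volume.restrict (parabolicCylinder (Real.exp σ * R) (0 : ℝ × EuclideanSpace ℝ (Fin 3)))) := by
      have hz : eLpNorm (G k - Hk k) 3 μR =
          ‖c k‖ₑ * (ENNReal.ofReal (c k ^ 2 * c k ^ 3)⁻¹) ^ (1 / (3 : ℝ≥0∞).toReal) *
            eLpNorm (uncurry w - uncurry (u k)) 3
              (volume.restrict (parabolicCylinder (c k * R) (0 : ℝ × EuclideanSpace ℝ (Fin 3)))) := by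
        rw [hG, hHk, hμR]
        dsimp only
        rw [nsRescale_eq_zoom, nsRescale_eq_zoom, eLpNorm_zoom_sub_zoom _ _ (hc0 k) R]
      rw [hz, eLpNorm_sub_comm]
      have hK : ‖c k‖ₑ * (ENNReal.ofReal (c k ^ 2 * c k ^ 3)⁻¹) ^ (1 / (3 : ℝ≥0∞).toReal) ≤
          ENNReal.ofReal (Real.exp σ) :=
        (rlNearIdentityDSS_zoomConst_le (hc1 k)).trans (ENNReal.ofReal_le_ofReal (hcle k))
      have hmono : eLpNorm (uncurry (u k) - uncurry w) 3
          (volume.restrict (parabolicCylinder (c k * R) (0 : ℝ × EuclideanSpace ℝ (Fin 3)))) ≤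
          eLpNorm (uncurry (u k) - uncurry w) 3
            (volume.restrict (parabolicCylinder (Real.exp σ * R) (0 : ℝ × EuclideanSpace ℝ (Fin 3)))) :=
        eLpNorm_mono_measure _ (Measure.restrict_mono
          (SuitableCompactness.parabolicCylinder_zero_mono (by positivity)
            (mul_le_mul_of_nonneg_right (hcle k) hR.le)) le_rfl)
      exact mul_le_mul' hK hmono
    have hD : eLpNorm (Hk k - uncurry w) 3 μR ≤ eLpNorm (uncurry (u k) - uncurry w) 3 μR +
        eLpNorm (fun z : ℝ × EuclideanSpace ℝ (Fin 3) => rotZ (φ k) (w z.1 (rotZ (-φ k) z.2)) - w z.1 z.2) 3 μR := by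
      rw [eLpNorm_congr_ae ((hHae k).sub (ae_eq_refl _))]
      have e' : Rk k - uncurry w = (Rk k - Rw k) + (Rw k - uncurry w) := by rw [sub_add_sub_cancel]
      have h1 : eLpNorm (Rk k - Rw k) 3 μR = eLpNorm (uncurry (u k) - uncurry w) 3 μR :=
        rlRotAbs_eLpNorm_conj (φ k) R (hum1 k R hR) (hwm1 R hR)
      rw [e']
      refine (eLpNorm_add_le ((hRkm k).sub (hRwm k)) ((hRwm k).sub hWm) h13).trans_eq ?_
      rw [h1]
      rfl
    calc eLpNorm (F - uncurry w) 3 μR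
        ≤ eLpNorm (F - G k) 3 μR + eLpNorm ((G k - Hk k) + (Hk k - uncurry w)) 3 μR := by
          rw [e]; exact eLpNorm_add_le (hFm.sub (hGm k)) (((hGm k).sub (hHm k)).add ((hHm k).sub hWm)) h13
      _ ≤ eLpNorm (F - G k) 3 μR + (eLpNorm (G k - Hk k) 3 μR + eLpNorm (Hk k - uncurry w) 3 μR) :=
          add_le_add le_rfl (eLpNorm_add_le ((hGm k).sub (hHm k)) ((hHm k).sub hWm) h13)
      _ ≤ _ := by
          rw [← add_assoc]
          exact add_le_add (add_le_add le_rfl hB) hD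
  -- the terms tend to zero
  have hA : Tendsto (fun k => eLpNorm (F - G k) 3 μR) atTop (𝓝 0) := by
    -- `G k = (w_{r_k})_{e^σ}` with `r_k = c_k e^{-σ} → 1`
    set r : ℕ → ℝ := fun k => c k * Real.exp (-σ) with hr
    have hr1 : Tendsto r atTop (𝓝 1) := by
      have h := hclim.mul_const (Real.exp (-σ))
      rwa [← Real.exp_add, add_neg_cancel, Real.exp_zero] at h
    have e : ∀ k, eLpNorm (F - G k) 3 μR =
        ‖Real.exp σ‖ₑ * (ENNReal.ofReal (Real.exp σ ^ 2 * Real.exp σ ^ 3)⁻¹) ^ (1 / (3 : ℝ≥0∞).toReal) *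
          eLpNorm (uncurry (nsRescale (r k) w) - uncurry w) 3
            (volume.restrict (parabolicCylinder (Real.exp σ * R) (0 : ℝ × EuclideanSpace ℝ (Fin 3)))) := by
      intro k
      have eck : c k = r k * Real.exp σ := by
        rw [hr]; dsimp only; rw [mul_assoc, ← Real.exp_add, neg_add_cancel, Real.exp_zero, mul_one]
      rw [hF, hG, hμR]
      dsimp only
      rw [eck, nsRescale_mul, nsRescale_eq_zoom (Real.exp σ) w,
        nsRescale_eq_zoom (Real.exp σ) (nsRescale (r k) w), eLpNorm_zoom_sub_zoom _ _ he R,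
        eLpNorm_sub_comm]
    simp_rw [e]
    have hRσ : 0 < Real.exp σ * R := by positivity
    have h := ENNReal.Tendsto.const_mul ((horbit (Real.exp σ * R) hRσ).comp hr1)
      (Or.inr (zoomConst_ne_top (Real.exp σ)))
      (a := ‖Real.exp σ‖ₑ * (ENNReal.ofReal (Real.exp σ ^ 2 * Real.exp σ ^ 3)⁻¹) ^ (1 / (3 : ℝ≥0∞).toReal))
    rw [mul_zero] at h
    simpa only [Function.comp_def] using h
  have hB : Tendsto (fun k => ENNReal.ofReal (Real.exp σ) * eLpNorm (uncurry (u k) - uncurry w) 3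
      (volume.restrict (parabolicCylinder (Real.exp σ * R) (0 : ℝ × EuclideanSpace ℝ (Fin 3))))) atTop (𝓝 0) := by
    have hRσ : 0 < Real.exp σ * R := by positivity
    have h := ENNReal.Tendsto.const_mul (hconv (Real.exp σ * R) hRσ) (Or.inr ENNReal.ofReal_ne_top)
      (a := ENNReal.ofReal (Real.exp σ))
    rwa [mul_zero] at h
  have hD : Tendsto (fun k => eLpNorm (uncurry (u k) - uncurry w) 3 μR +
      eLpNorm (fun z : ℝ × EuclideanSpace ℝ (Fin 3) => rotZ (φ k) (w z.1 (rotZ (-φ k) z.2)) - w z.1 z.2) 3 μR)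
      atTop (𝓝 0) := by
    have h := (hconv R hR).add ((hrot R hR).comp hφ0)
    rw [add_zero] at h
    simpa only [Function.comp_def] using h
  exact rlNearIdentityDSS_eq_zero_of_le_three hle hA hB hD

/-- **Registered stub `stub_rlNearIdentityRDSSSlow`** (crux stmt-NavierStokesRegularity-1589, line
Sketch) — **no near-identity, slowly precessing rotated-DSS Type-I singularity models in the
Albritton–Barker class.**  For every rate constant `C` and bound `M < ⊤` there are `Λ > 1` and
`α_ > 0` such that every suitable weak solution `(u, p)` of Navier–Stokes (`ν = 1`, `f = 0`) on
`ℝ³ × ℝ₋` with weak gradient `G`, `𝐈(ℝ³ × ℝ₋) ≤ M`, the Type-I rate `‖u(t,x)‖ ≤ C/√(−t)`, which is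
a.e. `(λ, θ)`-rotated discretely self-similar on the slab — `λ u(λ²t, λx) = R_θ u(t, R_{−θ} x)` —
with `λ ∈ (1, Λ)` and `|θ| ≤ α_ log λ`, is regular at the space–time origin.  Proof: contradiction
(`Λ_k = 1 + 1/(k+1)`, `α_k = 1/(k+1)`), class limit (`stub_rlClassLimit`), a.e. scale invariance of
the limit (`rlRDSS_ball` for `σ > 0` on every ball, exhaustion, inversion for `σ < 0`), the Type-I
ancient mild self-similar representative (`stub_rlSelfSimilarRepr`) and the self-similar rung
(`stub_rlSelfSimilarMildVanishes`).
[cite: PineauVicol2026, Thms. 1.6–1.7] [cite: ChaeWolf2017RemovingDSS, Thm 1.3] [cite: Tsai1998, Thm 1] -/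
theorem stub_rlNearIdentityRDSSSlow :
    ∀ (C : ℝ) (M : ℝ≥0∞), M < ⊤ → ∃ Λ αlow : ℝ, 1 < Λ ∧ 0 < αlow ∧
      ∀ (lam θ : ℝ), 1 < lam → lam < Λ → |θ| ≤ αlow * Real.log lam →
        ∀ (u : ℝ → EuclideanSpace ℝ (Fin 3) → EuclideanSpace ℝ (Fin 3))
          (p : ℝ → EuclideanSpace ℝ (Fin 3) → ℝ)
          (G : ℝ → EuclideanSpace ℝ (Fin 3) → EuclideanSpace ℝ (Fin 3) →L[ℝ] EuclideanSpace ℝ (Fin 3)),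
          IsSuitableWeakSolutionOn (slab (EuclideanSpace ℝ (Fin 3)) (Iio 0) isOpen_Iio) 1 0 u p →
          HasWeakSpatialGradientOn (slab (EuclideanSpace ℝ (Fin 3)) (Iio 0) isOpen_Iio) u G →
          typeIBound (Iio (0 : ℝ) ×ˢ univ) u p G ≤ M →
          HasTypeITimeDecay C u →
          (∀ᵐ z ∂(volume.restrict (Iio (0 : ℝ) ×ˢ (univ : Set (EuclideanSpace ℝ (Fin 3))))),
            nsRescale lam u z.1 z.2 = rotZ θ (u z.1 (rotZ (-θ) z.2))) →
          ¬ IsBackwardSingularPoint u 0 := by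
  intro C M hM
  by_contra hcon
  push Not at hcon
  have hαk : ∀ k : ℕ, (0 : ℝ) < 1 / ((k : ℝ) + 1) := fun k => by positivity
  have hΛ : ∀ k : ℕ, (1 : ℝ) < 1 + 1 / ((k : ℝ) + 1) := fun k => by linarith [hαk k]
  choose lam θ hlam1 hlamΛ hθ u p G hsw hwg hI hdec hdss hsing using
    fun k : ℕ => hcon _ _ (hΛ k) (hαk k)
  -- `λ_k → 1` and `α_k = 1/(k+1) → 0`
  have hα : Tendsto (fun k : ℕ => 1 / ((k : ℝ) + 1)) atTop (𝓝 0) :=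
    tendsto_one_div_add_atTop_nhds_zero_nat (𝕜 := ℝ)
  have hlim : Tendsto lam atTop (𝓝 1) := by
    have h1 : Tendsto (fun k : ℕ => (1 : ℝ) + 1 / ((k : ℝ) + 1)) atTop (𝓝 1) := by
      have h := hα.const_add 1
      rwa [add_zero] at h
    exact tendsto_of_tendsto_of_tendsto_of_le_of_le tendsto_const_nhds h1
      (fun k => (hlam1 k).le) (fun k => (hlamΛ k).le)
  -- a singular class limit with the rate
  obtain ⟨w, q, H, ψ, hψ, hsw', hwg', hI', hdec', hsing', hconv⟩ :=
    stub_rlClassLimit C M hM u p G hsw hwg hI hdec hsing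
  -- measurability of (rescaled) class profiles on the balls
  have hmeas : ∀ (k : ℕ) (c : ℝ), 0 < c → ∀ R : ℝ, 0 < R →
      AEStronglyMeasurable (uncurry (nsRescale c (u k)))
        (volume.restrict (parabolicCylinder R (0 : ℝ × EuclideanSpace ℝ (Fin 3)))) := by
    intro k c hc R _
    rw [nsRescale_eq_zoom]
    exact (zoom_slabProfile (hsw k) (hwg k) hc).2.1.locallyIntegrableOn.aestronglyMeasurable.mono_measure
      (Measure.restrict_mono (parabolicCylinder_origin_subset_slab _) le_rfl)
  have hmeasw : ∀ (c : ℝ), 0 < c → ∀ R : ℝ, 0 < R →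
      AEStronglyMeasurable (uncurry (nsRescale c w))
        (volume.restrict (parabolicCylinder R (0 : ℝ × EuclideanSpace ℝ (Fin 3)))) := by
    intro c hc R _
    rw [nsRescale_eq_zoom]
    exact (zoom_slabProfile hsw' hwg' hc).2.1.locallyIntegrableOn.aestronglyMeasurable.mono_measure
      (Measure.restrict_mono (parabolicCylinder_origin_subset_slab _) le_rfl)
  -- the scaling orbit and the rotation orbit of `w` are continuous in `L³` on the balls
  have horbit := stub_rlOrbitContinuous w (fun R hR => memLp_three_of_slabProfile hwg' hI' hR)
  have hrot := stub_rlRotationOrbitContinuousTools w (fun R hR => memLp_three_of_slabProfile hwg' hI' hR)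
  -- a.e. scale invariance of `w` on the slab, first for `σ > 0` on every ball
  have hpos : ∀ σ : ℝ, 0 < σ → ∀ᵐ z ∂(volume.restrict (Iio (0 : ℝ) ×ˢ (univ : Set (EuclideanSpace ℝ (Fin 3))))),
      nsRescale (Real.exp σ) w z.1 z.2 = w z.1 z.2 := by
    intro σ hσ
    have hball : ∀ R : ℝ, 0 < R → ∀ᵐ z ∂(volume.restrict (parabolicCylinder R (0 : ℝ × EuclideanSpace ℝ (Fin 3)))),
        nsRescale (Real.exp σ) w z.1 z.2 = w z.1 z.2 := by
      intro R hR
      have h0 := rlRDSS_ball (lam := fun j => lam (ψ j)) (θ := fun j => θ (ψ j))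
        (α := fun j => 1 / (((ψ j : ℕ) : ℝ) + 1)) (fun j => hlam1 (ψ j)) (hlim.comp hψ.tendsto_atTop)
        (fun j => hθ (ψ j)) (hα.comp hψ.tendsto_atTop) (u := fun j => u (ψ j)) (fun j => hmeas (ψ j))
        hmeasw hconv (fun j => hdss (ψ j)) horbit hrot hσ hR
      have hwm1 : AEStronglyMeasurable (uncurry w)
          (volume.restrict (parabolicCylinder R (0 : ℝ × EuclideanSpace ℝ (Fin 3)))) := by
        have h := hmeasw 1 one_pos R hR
        rwa [nsRescale_one] at h
      rw [eLpNorm_eq_zero_iff ((hmeasw _ (Real.exp_pos σ) R hR).sub hwm1) (by norm_num)] at h0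
      filter_upwards [h0] with z hz
      rw [Pi.sub_apply, Pi.zero_apply, sub_eq_zero] at hz
      exact hz
    refine ae_restrict_of_ae_restrict_of_subset lowerHalf_subset_iUnion_parabolicCylinder ?_
    rw [ae_restrict_iUnion_iff]
    intro n
    exact hball _ (by positivity)
  have hss : ∀ σ : ℝ, ∀ᵐ z ∂(volume.restrict (Iio (0 : ℝ) ×ˢ (univ : Set (EuclideanSpace ℝ (Fin 3))))),
      nsRescale (Real.exp σ) w z.1 z.2 = w z.1 z.2 := by
    intro σ
    rcases lt_trichotomy σ 0 with hneg | hzero | hposσ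
    · have h := rlNearIdentityDSS_ae_inv (Real.exp_pos (-σ)) (hpos (-σ) (neg_pos.2 hneg))
      rwa [← Real.exp_neg, neg_neg] at h
    · subst hzero
      exact Eventually.of_forall fun z => by rw [Real.exp_zero, nsRescale_one]
    · exact hpos σ hposσ
  -- continuous, pointwise scale-invariant Type-I ancient mild representative; it vanishes (Tsai)
  obtain ⟨v, hv, hvss, hae⟩ := stub_rlSelfSimilarRepr C w q H hsw' hwg' hI' hdec' hss
  have hv0 : ∀ t : ℝ, t < 0 → ∀ x, v t x = 0 := stub_rlSelfSimilarMildVanishes C v hv hvss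
  -- hence `w = 0` a.e. on the slab and on `Q(0,1)`: not singular
  have hw0 : ∀ᵐ z ∂(volume.restrict (Iio (0 : ℝ) ×ˢ (univ : Set (EuclideanSpace ℝ (Fin 3))))),
      uncurry w z = (0 : ℝ × EuclideanSpace ℝ (Fin 3) → EuclideanSpace ℝ (Fin 3)) z := by
    filter_upwards [hae, ae_restrict_mem (measurableSet_Iio.prod MeasurableSet.univ)] with z hz hzm
    rw [hz, Pi.zero_apply]
    exact hv0 z.1 hzm.1 z.2
  have hQ : ∀ᵐ z ∂(volume.restrict (parabolicCylinder 1 (0 : ℝ × EuclideanSpace ℝ (Fin 3)))),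
      uncurry w z = (0 : ℝ × EuclideanSpace ℝ (Fin 3) → EuclideanSpace ℝ (Fin 3)) z :=
    ae_restrict_of_ae_restrict_of_subset (parabolicCylinder_origin_subset_slab 1) hw0
  have h0 : eLpNorm (uncurry w) ∞
      (volume.restrict (parabolicCylinder 1 (0 : ℝ × EuclideanSpace ℝ (Fin 3)))) = 0 := by
    rw [eLpNorm_congr_ae hQ, eLpNorm_zero]
  have htop := hsing' 1 one_pos
  rw [h0] at htop
  exact ENNReal.zero_ne_top htop

end Summit.NavierStokesRegularity.NavierStokesRegularity.Theorems

end
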